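import Summits.QuantumFields.YangMills.Theorems.UnitScaleTiltHalvingP1FlatCoreSupplierInductionSU
import Literature.MathematicalPhysics.QuantumFieldTheory.Balaban1983to89.B8SpecialLinearTrace
import Literature.MathematicalPhysics.QuantumFieldTheory.Balaban1983to89.B7Eq170Flat
import HarnessLib

/-!
# `hP1room` PROGRAMME (LEAD-H «H = hSupUρ3 ⟸ hMember», (K-site) located gap (G4)): ★★ THE DATUM's TRACE ROW `hAτ` — Theorem 4's chart one-form `A` is
# TRACE-FREE on every touched side, from the chart identity `W = e^{iηA}`, the `SU(2)`-valuedness of `W` and the size window `η‖A‖ ≤ c⋆ ≤ 1∕16`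

Route `UnitScaleTilt`, crux K1 child «MinimiserStabilityRegPr» (stmt-QuantumFields-19200), registered stub `stub_halvingStep` (`BirthV10`), text
`H = hSupUρ3 ⟸ hMember` (✓`HalvingHSupURho3OfSiteRows.hSupUρ3_of_siteRows`; per member the composer `siteRows_of_sockets` feeds ✓p654110
`HalvingHSiteTopRowsOfSockets.siteTopRows_of_sockets`, whose datum block carries the τ-row
`hAτ : ∀ j ≤ m, ∀ b ∈ {b ∣ SideTouches (Ω j) b}, τ (A b) = 0` at `τ := trCLM (Fin 2)`).  Cell `ym3-torus` (HUMAN RULING D-0037: YM₃ on T³ is ladder rung R3 —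
NOT d = 4, NOT a mass gap, NOT the Clay problem), width seat `ym-ust-19200-w3` gen 8 (H-door lineage).  `--supports stmt-QuantumFields-19200 --as helper`;
THEOREMS ONLY (0 `def`, 0 `sorry`); count-neutral; nothing here claims `hMember`, `hSupUρ3`, the stub, the crux or the gap.

WHY THIS FILE (★w3-20520 g6's call-graph memo `KSITE-FULL-CALLGRAPH-w3g6.md` §2, gap (G4)).  The (τ-D) junction ✓p654692
`HalvingP1FlatCoreSupplierInductionSU.datum_of_preGauge_cubeMember_SU` emits Theorem 4's datum `(u, W, A)` at level `m` with `u` `SU(2)`-valued,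
`hW : mgauge 1 u W = U′` and `hdat : W b = cfgExp η A b ∧ IsSelfAdjoint (A b) ∧ ‖A b‖ ≤ c⋆·(Lʲη)⁻¹` on the touched sides — but NO trace conjunct.  The consumer
derives it here (no v1.1 of a landed file): `W b = (u x)⁻¹·U′ b·u (x + e_κ) ∈ SL(2, ℂ)` (`U′`, `u` special unitary), `W b = e^{S}` with `S := i η A b`,
`‖S‖ = η‖A b‖ ≤ c⋆∕Lʲ ≤ 1∕16`, hence `‖W b − 1‖ ≤ e^{1∕16} − 1 ≤ ⅛` (lit ✓`Balaban1983to89.norm_exp_sub_one_le_exp_norm_sub_one`), `tr log W b = 0`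
(lit ✓`B8SpecialLinearTrace.trCLM_mlog_eq_zero_of_mem_slUnits`: `e^{tr log h} = det h = 1`, `|tr log h| < 2π`), `log e^{S} = S` (lit ✓`B7Eq170Flat.mlog_exp_of_le`,
`‖S‖ ≤ ⅕`), so `iη·tr A b = 0`, `tr A b = 0`.

WHAT.
* §1 ★ `trCLM_eq_zero_of_expUnit_mem_slUnits` — `‖S‖ ≤ 1∕16`, `e^{S} ∈ SL(2, ℂ)` ⟹ `tr S = 0`; ★ `trCLM_eq_zero_of_cfgExp_mem_slUnits` — `η‖A x μ‖ ≤ 1∕16`,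
  `cfgExp η A x μ ∈ SL(2, ℂ)`, `η ≠ 0` ⟹ `tr (A x μ) = 0`.
* §2 ★ `mem_slUnits_of_mgauge_one` — `mgauge 1 u W = U′`, `u x, u (x + e_κ), U′ x κ ∈ SL(2, ℂ)` ⟹ `W x κ ∈ SL(2, ℂ)`; `pull_unitsField_toUField_mem_SU` — J3's
  letter `U′ := pull (unitsField (toUField V)) y` is `SU(2)`-valued for every `SU(2)` torus field `V`.
* §3 ★★ `hAτ_of_datum` — THE ROW in ✓p654110's letters: `∀ j ≤ m, ∀ b ∈ {b ∣ SideTouches (Ω j) b.1 b.2}, trCLM (Fin 2) (A b.1 b.2) = 0` from `hU′SU`, `huSU`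
  ((τ-D)'s `hu₁SU` form), `hW`, `hdat` and the window `c⋆ ≤ 1∕16` (`1 ≤ L`; in the composer `L·c⋆ ≤ 1∕12`, `L ≥ 2`); ★★ `hAτ_of_datum_pull` — the same with `hU′SU`
  discharged for `U′ := pull (unitsField (toUField V)) y`.
HONEST SCOPE.  Liouville + the matrix logarithm on a ball; no analytic content of Theorem 4; the sockets of ✓p654692 stay displayed there.

References: T. Bałaban, CMP **98** (1985) 17–51 [Balaban1985Averaging] ((19)–(23) pp.20–21, «G = SU(N)» p.20); CMP **99** (1985) 75–102 [Balaban1985RegularSpaces]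
(Thm 4 p.88, (1.36) p.82, (1.68)–(1.69) p.88, p.76).
-/

set_option autoImplicit false

noncomputable section

open scoped Matrix.Norms.L2Operator

namespace Summit.QuantumFields.YangMills.Theorems.HalvingP1FlatCoreSupplierDatumTrace

open NormedSpace
open Complex (I)
open Literature.MathematicalPhysics.QuantumFieldTheory.Balaban1983to89
open Literature.MathematicalPhysics.QuantumFieldTheory.Balaban1983to89.T3ContinuumYM3Torus
open MatrixLog (mlog)
open B7Prop1Explicit renaming Site → LSite
open B7Prop1Explicit (e expUnit val_expUnit)
open B7Prop2SpecialUnitary (specialUnitaryUnits mem_specialUnitaryUnits)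
open B7Eq92Concrete (mgauge mgauge_apply Rc_one_apply)
open B7Eq170Flat (mlog_exp_of_le)
open B8Eq140Level (SideTouches)
open B8Eq184Proof (cfgExp)
open B8SpecialUnitaryTrace (trCLM trCLM_apply)
open B8SpecialLinearTrace (specialUnitaryUnits_le_slUnits trCLM_mlog_eq_zero_of_mem_slUnits)
open B13Inv214OrbitSUN (slUnits mem_slUnits_iff)
open B10Eq27TorusAxialLog (pull pull_apply unitsField toUField val_unitsField val_suIncl)

/-! ## §1 Liouville + the logarithm on a ball: `e^{S} ∈ SL(2, ℂ)`, `‖S‖ ≤ 1∕16` ⟹ `tr S = 0` -/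

/-- `e^{1∕16} − 1 ≤ ⅛`. -/
theorem exp_one_div_sixteen_sub_one_le : Real.exp (1 / 16) - 1 ≤ 1 / 8 := by
  have h := Real.abs_exp_sub_one_sub_id_le (x := (1 / 16 : ℝ)) (by rw [abs_of_nonneg (by norm_num)]; norm_num)
  have h' := (abs_le.1 h).2
  nlinarith [h']

/-- ★ For `S ∈ M₂(ℂ)` with `‖S‖ ≤ 1∕16` and `e^{S} ∈ SL(2, ℂ)`: `tr S = 0` (`‖e^{S} − 1‖ ≤ e^{1∕16} − 1 ≤ ⅛`, `tr log e^{S} = 0` by Liouville and `|tr log| < 2π`,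
`log e^{S} = S`). [cite: Balaban1985Averaging, (20)-(23) pp.20-21] -/
theorem trCLM_eq_zero_of_expUnit_mem_slUnits {S : Matrix (Fin 2) (Fin 2) ℂ} (hS : ‖S‖ ≤ 1 / 16) (hdet : expUnit S ∈ slUnits 2) :
    trCLM (Fin 2) S = 0 := by
  letI : CStarAlgebra (Matrix (Fin 2) (Fin 2) ℂ) := B10Eq29TubeLine.cstarAlgebraMatrix 2
  have h1 : ‖((expUnit S : (Matrix (Fin 2) (Fin 2) ℂ)ˣ) : Matrix (Fin 2) (Fin 2) ℂ) - 1‖ ≤ 1 / 8 := by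
    rw [val_expUnit]
    calc ‖exp S - 1‖ ≤ Real.exp ‖S‖ - 1 := norm_exp_sub_one_le_exp_norm_sub_one _
      _ ≤ Real.exp (1 / 16) - 1 := by linarith [Real.exp_le_exp.2 hS]
      _ ≤ 1 / 8 := exp_one_div_sixteen_sub_one_le
  have h2 := trCLM_mlog_eq_zero_of_mem_slUnits (N := 2) (by norm_num) hdet h1
  rwa [val_expUnit, mlog_exp_of_le (hS.trans (by norm_num))] at h2

/-- ★ For the exponential chart `cfgExp η A x μ = e^{iηA(x,μ)}`: `η‖A x μ‖ ≤ 1∕16`, `η ≠ 0`, `cfgExp η A x μ ∈ SL(2, ℂ)` ⟹ `tr A x μ = 0`.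
[cite: Balaban1985RegularSpaces, (1.36) p.82; Balaban1985Averaging, (20)-(23) pp.20-21] -/
theorem trCLM_eq_zero_of_cfgExp_mem_slUnits {d : ℕ} {η : ℝ} (hη : η ≠ 0) (hη0 : 0 ≤ η) {A : LSite d → Fin d → Matrix (Fin 2) (Fin 2) ℂ}
    (x : LSite d) (μ : Fin d) (hA : η * ‖A x μ‖ ≤ 1 / 16) (hdet : cfgExp η A x μ ∈ slUnits 2) :
    trCLM (Fin 2) (A x μ) = 0 := by
  have hS : ‖I • (η • A x μ)‖ ≤ 1 / 16 := by
    rw [norm_smul, Complex.norm_I, one_mul, norm_smul, Real.norm_of_nonneg hη0]; exact hA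
  have h := trCLM_eq_zero_of_expUnit_mem_slUnits hS hdet
  have hIη : I • (η • A x μ) = (I * (η : ℂ)) • A x μ := by rw [← Complex.coe_smul, smul_smul]
  rw [hIη, map_smul, smul_eq_zero] at h
  rcases h with h | h
  · exact absurd h (mul_ne_zero Complex.I_ne_zero (Complex.ofReal_ne_zero.2 hη))
  · exact h

/-! ## §2 `SL(2, ℂ)`-valuedness of the datum's `W` from `W^{u} = U′` -/

/-- ★ `mgauge 1 u W = U′` at a bond: `W x κ = (u x)⁻¹ · U′ x κ · u (x + e κ)`, so `W x κ ∈ SL(2, ℂ)` when `u x`, `u (x + e κ)`, `U′ x κ` are.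
[cite: Balaban1985Averaging, (55) p.27, p.20] -/
theorem mem_slUnits_of_mgauge_one {d : ℕ} {u : LSite d → (Matrix (Fin 2) (Fin 2) ℂ)ˣ} {W U' : LSite d → Fin d → (Matrix (Fin 2) (Fin 2) ℂ)ˣ}
    (hW : mgauge (1 : LSite d → Fin d → (Matrix (Fin 2) (Fin 2) ℂ)ˣ) u W = U') (x : LSite d) (κ : Fin d)
    (hux : u x ∈ slUnits 2) (huxκ : u (x + e κ) ∈ slUnits 2) (hU : U' x κ ∈ slUnits 2) : W x κ ∈ slUnits 2 := by
  have h := congrFun (congrFun hW x) κ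
  rw [mgauge_apply, Pi.one_apply, Pi.one_apply, Rc_one_apply] at h
  have hWeq : W x κ = (u x)⁻¹ * U' x κ * u (x + e κ) := by
    rw [← h]; group
  rw [hWeq]
  exact (slUnits 2).mul_mem ((slUnits 2).mul_mem ((slUnits 2).inv_mem hux) hU) huxκ

/-- `SU(2)`-valued (matrix form) ⟹ `SL(2, ℂ)`-valued. [cite: Balaban1985Averaging, p.20] -/
theorem mem_slUnits_of_val_mem_SU {g : (Matrix (Fin 2) (Fin 2) ℂ)ˣ} (hg : (g : Matrix (Fin 2) (Fin 2) ℂ) ∈ Matrix.specialUnitaryGroup (Fin 2) ℂ) :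
    g ∈ slUnits 2 :=
  specialUnitaryUnits_le_slUnits (mem_specialUnitaryUnits.2 hg)

/-- J3's letter `U′ := pull (unitsField (toUField V)) y` is `SU(2)`-valued for every `SU(2)` torus field `V`. [cite: Balaban1985Averaging, (9) p.18, (19) p.21] -/
theorem pull_unitsField_toUField_mem_SU {P : Params} {j : ℕ} (V : GaugeField P j (Matrix.specialUnitaryGroup (Fin 2) ℂ)) (y : Site P j)
    (z : LSite P.d) (μ : Fin P.d) :
    ((pull (unitsField (toUField V)) y z μ : (Matrix (Fin 2) (Fin 2) ℂ)ˣ) : Matrix (Fin 2) (Fin 2) ℂ) ∈ Matrix.specialUnitaryGroup (Fin 2) ℂ := by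
  rw [pull_apply, val_unitsField]
  exact (V _).2

/-! ## §3 The row `hAτ` in ✓p654110's letters -/

/-- ★★ **THE DATUM's TRACE ROW (gap (G4)).**  From `U′` and `u` `SU(2)`-valued, `hW : mgauge 1 u W = U′`, Theorem 4's chart-with-size rows `hdat` on the touched sides
of the member's cubes `Ω j` and the window `c⋆ ≤ 1∕16` (`1 ≤ L`, `0 < η`): `trCLM (Fin 2) (A b) = 0` on every touched side — the `hAτ` input of
✓`HalvingHSiteTopRowsOfSockets.siteTopRows_of_sockets` at `τ := trCLM (Fin 2)`. [cite: Balaban1985RegularSpaces, Thm 4 p.88, (1.36) p.82, (1.68)-(1.69) p.88, p.76; Balaban1985Averaging, (20)-(23) pp.20-21] -/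
theorem hAτ_of_datum {d : ℕ} {η : ℝ} (hη : 0 < η) {L : ℕ} (hL : 1 ≤ L) {m : ℕ} (Ω : ℕ → Set (LSite d))
    {U' : LSite d → Fin d → (Matrix (Fin 2) (Fin 2) ℂ)ˣ}
    (hU'SU : ∀ x κ, ((U' x κ : (Matrix (Fin 2) (Fin 2) ℂ)ˣ) : Matrix (Fin 2) (Fin 2) ℂ) ∈ Matrix.specialUnitaryGroup (Fin 2) ℂ)
    {u : LSite d → (Matrix (Fin 2) (Fin 2) ℂ)ˣ} (huSU : ∀ x, ((u x : (Matrix (Fin 2) (Fin 2) ℂ)ˣ) : Matrix (Fin 2) (Fin 2) ℂ) ∈ Matrix.specialUnitaryGroup (Fin 2) ℂ)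
    {W : LSite d → Fin d → (Matrix (Fin 2) (Fin 2) ℂ)ˣ} (hW : mgauge (1 : LSite d → Fin d → (Matrix (Fin 2) (Fin 2) ℂ)ˣ) u W = U')
    {A : LSite d → Fin d → Matrix (Fin 2) (Fin 2) ℂ} {cs : ℝ} (hcs : cs ≤ 1 / 16)
    (hdat : ∀ j, j ≤ m → ∀ b ∈ {b : LSite d × Fin d | SideTouches (Ω j) b.1 b.2},
      W b.1 b.2 = cfgExp η A b.1 b.2 ∧ IsSelfAdjoint (A b.1 b.2) ∧ ‖A b.1 b.2‖ ≤ cs * ((L : ℝ) ^ j * η)⁻¹) :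
    ∀ j, j ≤ m → ∀ b ∈ {b : LSite d × Fin d | SideTouches (Ω j) b.1 b.2}, trCLM (Fin 2) (A b.1 b.2) = 0 := by
  intro j hj b hb
  obtain ⟨hWb, -, hAb⟩ := hdat j hj b hb
  have hLj : (1 : ℝ) ≤ (L : ℝ) ^ j := one_le_pow₀ (by exact_mod_cast hL)
  have hLjη : 0 < (L : ℝ) ^ j * η := mul_pos (lt_of_lt_of_le one_pos hLj) hη
  -- the window: `η‖A b‖ ≤ cs ∕ Lʲ ≤ cs ≤ 1∕16`
  have hA : η * ‖A b.1 b.2‖ ≤ 1 / 16 := by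
    have h1 : η * ‖A b.1 b.2‖ ≤ η * (cs * ((L : ℝ) ^ j * η)⁻¹) := mul_le_mul_of_nonneg_left hAb hη.le
    have h2 : η * (cs * ((L : ℝ) ^ j * η)⁻¹) = cs / (L : ℝ) ^ j := by
      field_simp
    have hcs0 : 0 ≤ cs := by
      have h0 : 0 ≤ cs * ((L : ℝ) ^ j * η)⁻¹ := (norm_nonneg (A b.1 b.2)).trans hAb
      exact (mul_nonneg_iff_of_pos_right (inv_pos.2 hLjη)).1 h0
    have h3 : cs / (L : ℝ) ^ j ≤ cs := div_le_self hcs0 hLj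
    linarith [h1, h2.le, h3, hcs]
  -- `W b ∈ SL(2, ℂ)`, hence the chart value is
  have hdet : cfgExp η A b.1 b.2 ∈ slUnits 2 := by
    rw [← hWb]
    exact mem_slUnits_of_mgauge_one hW b.1 b.2 (mem_slUnits_of_val_mem_SU (huSU _)) (mem_slUnits_of_val_mem_SU (huSU _))
      (mem_slUnits_of_val_mem_SU (hU'SU _ _))
  exact trCLM_eq_zero_of_cfgExp_mem_slUnits hη.ne' hη.le b.1 b.2 hA hdet

/-- ★★ **THE DATUM's TRACE ROW, `U′ := pull (unitsField (toUField V)) y`** (J3's pre-gauged field of an `SU(2)` torus field `V := U^{gJ}`): as `hAτ_of_datum` with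
`hU′SU` discharged. [cite: Balaban1985RegularSpaces, Thm 4 p.88, (1.36) p.82; Balaban1985Averaging, (9) p.18, (19)-(23) pp.20-21] -/
theorem hAτ_of_datum_pull {P : Params} {i : ℕ} (V : GaugeField P i (Matrix.specialUnitaryGroup (Fin 2) ℂ)) (y : Site P i)
    {η : ℝ} (hη : 0 < η) {L : ℕ} (hL : 1 ≤ L) {m : ℕ} (Ω : ℕ → Set (LSite P.d))
    {u : LSite P.d → (Matrix (Fin 2) (Fin 2) ℂ)ˣ} (huSU : ∀ x, ((u x : (Matrix (Fin 2) (Fin 2) ℂ)ˣ) : Matrix (Fin 2) (Fin 2) ℂ) ∈ Matrix.specialUnitaryGroup (Fin 2) ℂ)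
    {W : LSite P.d → Fin P.d → (Matrix (Fin 2) (Fin 2) ℂ)ˣ} (hW : mgauge (1 : LSite P.d → Fin P.d → (Matrix (Fin 2) (Fin 2) ℂ)ˣ) u W = pull (unitsField (toUField V)) y)
    {A : LSite P.d → Fin P.d → Matrix (Fin 2) (Fin 2) ℂ} {cs : ℝ} (hcs : cs ≤ 1 / 16)
    (hdat : ∀ j, j ≤ m → ∀ b ∈ {b : LSite P.d × Fin P.d | SideTouches (Ω j) b.1 b.2},
      W b.1 b.2 = cfgExp η A b.1 b.2 ∧ IsSelfAdjoint (A b.1 b.2) ∧ ‖A b.1 b.2‖ ≤ cs * ((L : ℝ) ^ j * η)⁻¹) :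
    ∀ j, j ≤ m → ∀ b ∈ {b : LSite P.d × Fin P.d | SideTouches (Ω j) b.1 b.2}, trCLM (Fin 2) (A b.1 b.2) = 0 :=
  hAτ_of_datum hη hL Ω (fun x κ => pull_unitsField_toUField_mem_SU V y x κ) huSU hW hcs hdat

end Summit.QuantumFields.YangMills.Theorems.HalvingP1FlatCoreSupplierDatumTrace

end
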